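import Literature.NumberTheory.LFunctions.ExplicitFormulaPsiOne
import Literature.NumberTheory.LFunctions.ZetaEulerLowerBound
import Mathlib.Analysis.ODE.Gronwall
import HarnessLib

/-!
# `1/ζ(s)` on horizontal segments across the critical strip, at good heights

Topic `Literature/NumberTheory/LFunctions`. Everything in this file is PROVED.

Explicit formulae "of `1/ζ` type" — sums over the zeros `ρ` of `ζ` with coefficients `1/ζ'(ρ)`,
as for `M(x) = ∑ μ(n)` or Pólya's `L(x) = ∑ λ(n)` (Anderson–Stark, *Oscillation theorems*, LNM 899,
§4; Titchmarsh §14.27) — move a line of integration across the critical strip along horizontal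
segments `Im s = ±T` that avoid the zeros, and need `1/ζ(σ ± iT)` to be not too large there,
uniformly in `σ`. Titchmarsh's Theorem 9.7 gives `1/ζ(σ + iT) = O(T^A)` (`−1 ≤ σ ≤ 2`) for a
suitable `T` in every unit interval. This file proves the weaker but sufficient form that follows
at once from what the tree already has: at the **good heights** `T ∈ [N, N+1]` of
`Literature.NumberTheory.LFunctions.ZetaZeroSum.exists_goodHeight_log` (every ordinate of a
non-trivial zero is at distance `≥ η`, `1/η ≤ A log(N+6)`) the tree bounds
`|ζ'/ζ(σ + iT)| ≤ C log(|T|+4)/η` for `σ ∈ [−1/2, 3/2]`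
(`Literature.NumberTheory.LFunctions.PsiOneExplicit.exists_norm_logDeriv_riemannZeta_horizontal_le`);
integrating the logarithmic derivative along the segment from `σ = 3/2`, where
`|1/ζ| ≤ ζ(3/2)/ζ(3)` (`norm_inv_riemannZeta_le_div`), gives

  `‖1/ζ(σ ± iT)‖ ≤ A · exp(A log²(N+6))`,  `σ ∈ [−1/2, 3/2]`
  (`exists_goodHeight_norm_inv_riemannZeta_le`),

i.e. `1/ζ = exp(O(log² T))` on these segments — more than enough against the Gaussian kernels
`e^{ε(s−½)²}` of Anderson–Stark's Lemma 1 / Theorem 1 (for which any `exp(o(T²))` would do), which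
is what this file is for (the Gaussian explicit formula for `L(x)`, unit `AndersonStark1981_liouville`).

* `norm_inv_le_norm_inv_mul_exp` — Grönwall along a horizontal segment: if `f` is holomorphic and
  zero-free on `{u + it : a ≤ u ≤ b}` with `‖f'/f‖ ≤ M` there, then
  `‖1/f(a+it)‖ ≤ ‖1/f(b+it)‖ · e^{M(b−a)}`.
* `exists_norm_inv_riemannZeta_horizontal_le` — at a height `|t| ≥ 2` with all ordinates `η`-away
  (`0 < η ≤ 1`): `‖1/ζ(σ+it)‖ ≤ C exp(C log(|t|+4)/η)` for `σ ∈ [−1/2, 3/2]`.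
* `exists_goodHeight_norm_inv_riemannZeta_le` — the packaged form at the good heights, at `T` and
  at `−T`.

## References

* [Titchmarsh1986] E. C. Titchmarsh, *The Theory of the Riemann Zeta-Function*, 2nd ed. (1986),
  §9.6–9.7, Theorem 9.7 (the sharper `O(T^A)`; not needed here).
* [AndersonStark1981] R. J. Anderson, H. M. Stark, *Oscillation theorems*, LNM 899 (1981), §4,
  proof of Theorem 1 (the hypothesis "`G(s) = O(exp(T^{3/2}))` uniformly for `s = σ ± iT_j`").
* [MontgomeryVaughan2007] H. L. Montgomery, R. C. Vaughan, *Multiplicative Number Theory I*,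
  Lemma 12.2 (the horizontal bound for `ζ'/ζ`, through the tree).
-/

noncomputable section

open Complex Set Filter
open scoped Real Topology

namespace Literature.NumberTheory.LFunctions

/-! ## Grönwall along a horizontal segment -/

/-- **Integrating a bound on the logarithmic derivative.** If `f` is complex differentiable and
zero-free at every point `u + it`, `a ≤ u ≤ b`, of a horizontal segment and `‖f'/f‖ ≤ M` there,
then `‖1/f(a + it)‖ ≤ ‖1/f(b + it)‖ · exp(M (b − a))` (Grönwall's inequality for
`x ↦ 1/f(b − x + it)`, whose derivative is `(f'/f) · (1/f)`). [folklore] -/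
theorem norm_inv_le_norm_inv_mul_exp {f : ℂ → ℂ} {a b t M : ℝ} (hab : a ≤ b)
    (hf : ∀ u : ℝ, u ∈ Icc a b → DifferentiableAt ℂ f (u + t * I))
    (hne : ∀ u : ℝ, u ∈ Icc a b → f (u + t * I) ≠ 0)
    (hM : ∀ u : ℝ, u ∈ Icc a b → ‖deriv f (u + t * I) / f (u + t * I)‖ ≤ M) :
    ‖(f (a + t * I))⁻¹‖ ≤ ‖(f (b + t * I))⁻¹‖ * Real.exp (M * (b - a)) := by
  -- `g x = (f (b + it - x))⁻¹` on `[0, b - a]`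
  set g : ℝ → ℂ := fun x ↦ (f ((b : ℂ) + t * I - x))⁻¹ with hg
  set g' : ℝ → ℂ := fun x ↦
    deriv f ((b : ℂ) + t * I - x) / (f ((b : ℂ) + t * I - x)) ^ 2 with hg'
  have hpt : ∀ x : ℝ, (b : ℂ) + t * I - x = ((b - x : ℝ) : ℂ) + t * I := by
    intro x; push_cast; ring
  have hmem : ∀ {x : ℝ}, x ∈ Icc (0 : ℝ) (b - a) → b - x ∈ Icc a b := fun hx ↦
    ⟨by linarith [hx.2], by linarith [hx.1]⟩
  have hne' : ∀ {x : ℝ}, x ∈ Icc (0 : ℝ) (b - a) → f ((b : ℂ) + t * I - x) ≠ 0 := fun hx ↦ by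
    rw [hpt]; exact hne _ (hmem hx)
  have hderiv : ∀ x ∈ Icc (0 : ℝ) (b - a), HasDerivAt g (g' x) x := by
    intro x hx
    have hfp : HasDerivAt f (deriv f ((b : ℂ) + t * I - x)) ((b : ℂ) + t * I - x) := by
      have := (hf _ (hmem hx)).hasDerivAt
      rwa [hpt]
    have hψ : HasDerivAt (fun z : ℂ ↦ (b : ℂ) + t * I - z) (-1) (x : ℂ) := by
      simpa using (hasDerivAt_id (x : ℂ)).const_sub ((b : ℂ) + t * I)
    have hcomp : HasDerivAt (fun z : ℂ ↦ f ((b : ℂ) + t * I - z))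
        (deriv f ((b : ℂ) + t * I - x) * (-1)) (x : ℂ) := hfp.comp (x : ℂ) hψ
    have hinv := (hcomp.inv (hne' hx)).comp_ofReal
    have hval : g' x = -(deriv f ((b : ℂ) + t * I - x) * -1) / f ((b : ℂ) + t * I - x) ^ 2 := by
      simp only [hg']; ring
    rw [hval]
    exact hinv
  have hcont : ContinuousOn g (Icc 0 (b - a)) :=
    fun x hx ↦ (hderiv x hx).continuousAt.continuousWithinAt
  have hbound : ∀ x ∈ Ico (0 : ℝ) (b - a), ‖g' x‖ ≤ M * ‖g x‖ + 0 := by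
    intro x hx
    have hx' : x ∈ Icc (0 : ℝ) (b - a) := Ico_subset_Icc_self hx
    have h1 := hM _ (hmem hx')
    rw [← hpt] at h1
    rw [add_zero]
    simp only [hg', hg, norm_div, norm_pow, norm_inv]
    rw [norm_div] at h1
    rw [sq, div_mul_eq_div_div, div_eq_mul_inv]
    exact mul_le_mul_of_nonneg_right h1 (inv_nonneg.2 (norm_nonneg _))
  have hG := norm_le_gronwallBound_of_norm_deriv_right_le hcont
    (fun x hx ↦ (hderiv x (Ico_subset_Icc_self hx)).hasDerivWithinAt) le_rfl hbound (b - a)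
    ⟨by linarith, le_rfl⟩
  rw [gronwallBound_ε0, sub_zero] at hG
  have h0 : g 0 = (f ((b : ℂ) + t * I))⁻¹ := by simp [hg]
  have h1 : g (b - a) = (f ((a : ℂ) + t * I))⁻¹ := by
    simp only [hg]; congr 2; push_cast; ring
  rw [h1, h0] at hG
  exact hG

/-! ## `1/ζ` on `σ ∈ [−1/2, 3/2]` at separated heights -/

/-- At `σ = 3/2`: `‖1/ζ(3/2 + it)‖ ≤ ζ(3/2)/ζ(3)` (Euler product, Titchmarsh (8.7.1), the tree's
`norm_inv_riemannZeta_le_div`). [cite: Titchmarsh1986, Thm. 8.7 eq. (8.7.1)] -/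
theorem norm_inv_riemannZeta_three_halves_le (t : ℝ) :
    ‖(riemannZeta ((3 / 2 : ℝ) + t * I))⁻¹‖ ≤
      ‖riemannZeta ((3 / 2 : ℝ) : ℂ)‖ / ‖riemannZeta ((3 : ℝ) : ℂ)‖ := by
  have hre : (((3 / 2 : ℝ) : ℂ) + t * I).re = 3 / 2 := by simp
  have hs : 1 < (((3 / 2 : ℝ) : ℂ) + t * I).re := by rw [hre]; norm_num
  have h := norm_inv_riemannZeta_le_div hs
  rw [hre] at h
  have h3 : ((2 * (3 / 2 : ℝ) : ℝ) : ℂ) = ((3 : ℝ) : ℂ) := by norm_num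
  rwa [h3] at h

/-- **`1/ζ` on a horizontal segment at a separated height.** There is `C > 0` such that for
`|t| ≥ 2`, `0 < η ≤ 1`, all non-trivial zeros `η`-away from the ordinate `t`, and
`σ ∈ [−1/2, 3/2]`: `‖1/ζ(σ + it)‖ ≤ C exp(C log(|t| + 4)/η)`. Proof: `ζ ≠ 0` on the segment
(a zero `u + it`, `t ≠ 0`, would be a non-trivial zero of ordinate `t`), `|ζ'/ζ| ≤ C₁ log(|t|+4)/η`
there (the tree), and `norm_inv_le_norm_inv_mul_exp` from `σ` to `3/2`; cf. Titchmarsh Thm. 9.7 for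
the sharper `O(T^A)`. [folklore] -/
theorem exists_norm_inv_riemannZeta_horizontal_le :
    ∃ C : ℝ, 0 < C ∧ ∀ (t η : ℝ), 2 ≤ |t| → 0 < η → η ≤ 1 →
      (∀ ρ ∈ RHWave0.riemannZetaNontrivialZeros, η ≤ |ρ.im - t|) →
      ∀ σ : ℝ, σ ∈ Icc (-(1 / 2) : ℝ) (3 / 2) →
        ‖(riemannZeta (σ + t * I))⁻¹‖ ≤ C * Real.exp (C * Real.log (|t| + 4) / η) := by
  obtain ⟨C₁, hC₁, h₁⟩ := PsiOneExplicit.exists_norm_logDeriv_riemannZeta_horizontal_le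
  set K : ℝ := ‖riemannZeta ((3 / 2 : ℝ) : ℂ)‖ / ‖riemannZeta ((3 : ℝ) : ℂ)‖ with hK
  have hK0 : 0 ≤ K := by positivity
  refine ⟨2 * C₁ + K + 1, by positivity, fun t η ht hη hη1 hsep σ hσ ↦ ?_⟩
  have ht0 : t ≠ 0 := fun h ↦ by rw [h] at ht; norm_num at ht
  -- zero-free on the segment
  have hne : ∀ u : ℝ, u ∈ Icc σ (3 / 2) → riemannZeta (u + t * I) ≠ 0 := by
    intro u _ hz
    have hmem : (u : ℂ) + t * I ∈ RHWave0.riemannZetaNontrivialZeros :=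
      ZetaZeros.riemannZetaNontrivialZeros.mem_of_im_ne_zero hz (by simpa using ht0)
    have := hsep _ hmem
    simp at this
    linarith
  have hdiff : ∀ u : ℝ, u ∈ Icc σ (3 / 2) → DifferentiableAt ℂ riemannZeta (u + t * I) :=
    fun u _ ↦ differentiableAt_riemannZeta (fun h ↦ ht0 (by simpa using congrArg Complex.im h))
  have hM : ∀ u : ℝ, u ∈ Icc σ (3 / 2) →
      ‖deriv riemannZeta (u + t * I) / riemannZeta (u + t * I)‖ ≤ C₁ * Real.log (|t| + 4) / η :=
    fun u hu ↦ h₁ t η ht hη hη1 hsep u ⟨by linarith [hσ.1, hu.1], hu.2⟩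
  have hG := norm_inv_le_norm_inv_mul_exp hσ.2 hdiff hne hM
  have h32 := norm_inv_riemannZeta_three_halves_le t
  set L : ℝ := Real.log (|t| + 4) with hL
  have hL0 : 0 ≤ L := Real.log_nonneg (by linarith [abs_nonneg t])
  have hLη : 0 ≤ L / η := div_nonneg hL0 hη.le
  have hexp : Real.exp (C₁ * L / η * (3 / 2 - σ)) ≤ Real.exp ((2 * C₁ + K + 1) * L / η) := by
    apply Real.exp_le_exp.2
    have h2 : 3 / 2 - σ ≤ 2 := by linarith [hσ.1]
    have hpos : 0 ≤ C₁ * L / η := by positivity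
    calc C₁ * L / η * (3 / 2 - σ) ≤ C₁ * L / η * 2 := mul_le_mul_of_nonneg_left h2 hpos
      _ = (2 * C₁) * (L / η) := by ring
      _ ≤ (2 * C₁ + K + 1) * (L / η) := by gcongr; linarith
      _ = (2 * C₁ + K + 1) * L / η := by ring
  calc ‖(riemannZeta (σ + t * I))⁻¹‖
      ≤ ‖(riemannZeta ((3 / 2 : ℝ) + t * I))⁻¹‖ * Real.exp (C₁ * L / η * (3 / 2 - σ)) := hG
    _ ≤ K * Real.exp ((2 * C₁ + K + 1) * L / η) :=
        mul_le_mul h32 hexp (Real.exp_pos _).le hK0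
    _ ≤ (2 * C₁ + K + 1) * Real.exp ((2 * C₁ + K + 1) * L / η) := by
        gcongr; linarith

/-- `‖1/ζ(σ − it)‖ = ‖1/ζ(σ + it)‖` (`ζ(s̄) = conj ζ(s)`, Mathlib's `riemannZeta_conj`). [folklore] -/
theorem norm_inv_riemannZeta_neg_im (σ t : ℝ) :
    ‖(riemannZeta (σ + (-t : ℝ) * I))⁻¹‖ = ‖(riemannZeta (σ + t * I))⁻¹‖ := by
  have h : (σ : ℂ) + (-t : ℝ) * I = (starRingEnd ℂ) ((σ : ℂ) + t * I) := by
    apply Complex.ext <;> simp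
  rw [h, riemannZeta_conj, norm_inv, norm_inv, Complex.norm_conj]

/-- **`1/ζ = exp(O(log² T))` on the horizontal segments at the good heights.** There is `A > 0`
such that for every `N ≥ 2` there is a height `T ∈ [N, N+1]` with: (i) a separation `η`,
`0 < η ≤ 1/2`, `1/η ≤ A log(N+6)`, from the ordinates of all non-trivial zeros (the good height of
`ZetaZeroSum.exists_goodHeight_log`), and (ii) for all `σ ∈ [−1/2, 3/2]`,
`‖1/ζ(σ + iT)‖, ‖1/ζ(σ − iT)‖ ≤ A exp(A log²(N+6))`. This is the input "`G(s) = O(exp(T^{3/2}))`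
uniformly for `s = σ ± iT_j`" of Anderson–Stark's Theorem 1 for `G = (ζ(2s)/ζ(s) − 1)/s`; cf.
Titchmarsh Thm. 9.7. [folklore] -/
theorem exists_goodHeight_norm_inv_riemannZeta_le :
    ∃ A : ℝ, 0 < A ∧ ∀ N : ℕ, 2 ≤ N → ∃ T : ℝ, (N : ℝ) ≤ T ∧ T ≤ N + 1 ∧
      (∃ η : ℝ, 0 < η ∧ η ≤ 1 / 2 ∧ 1 / η ≤ A * Real.log (N + 6) ∧
        ∀ ρ ∈ RHWave0.riemannZetaNontrivialZeros, η ≤ |ρ.im - T|) ∧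
      ∀ σ : ℝ, σ ∈ Icc (-(1 / 2) : ℝ) (3 / 2) →
        ‖(riemannZeta (σ + T * I))⁻¹‖ ≤ A * Real.exp (A * Real.log (N + 6) ^ 2) ∧
        ‖(riemannZeta (σ + (-T : ℝ) * I))⁻¹‖ ≤ A * Real.exp (A * Real.log (N + 6) ^ 2) := by
  obtain ⟨A₀, hA₀, hgood⟩ := ZetaZeroSum.exists_goodHeight_log
  obtain ⟨C, hC, hinv⟩ := exists_norm_inv_riemannZeta_horizontal_le
  refine ⟨A₀ + C * A₀ + C + 1, by positivity, fun N hN ↦ ?_⟩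
  obtain ⟨T, hNT, hTN, η, hη, hη2, hηA, hsep⟩ := hgood N hN
  have hN2 : (2 : ℝ) ≤ N := by exact_mod_cast hN
  have hT2 : 2 ≤ T := hN2.trans hNT
  have hTabs : |T| = T := abs_of_nonneg (by linarith)
  have hlog8 : 0 < Real.log ((N : ℝ) + 6) := Real.log_pos (by linarith)
  have hlogle : Real.log (|T| + 4) ≤ Real.log ((N : ℝ) + 6) := by
    rw [hTabs]
    exact Real.log_le_log (by linarith) (by linarith)
  have hlog0 : 0 ≤ Real.log (|T| + 4) := Real.log_nonneg (by linarith [abs_nonneg T])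
  set Λ : ℝ := Real.log ((N : ℝ) + 6) with hΛ
  -- the exponent: `C log(|T|+4)/η ≤ C A₀ log²(N+6) ≤ A log²(N+6)`
  have hkey : C * Real.log (|T| + 4) / η ≤ (A₀ + C * A₀ + C + 1) * Λ ^ 2 := by
    have h1 : C * Real.log (|T| + 4) / η = C * Real.log (|T| + 4) * (1 / η) := by ring
    rw [h1]
    calc C * Real.log (|T| + 4) * (1 / η) ≤ C * Λ * (A₀ * Λ) := by
          refine mul_le_mul (mul_le_mul_of_nonneg_left hlogle hC.le) hηA
            (div_nonneg one_pos.le hη.le) (by positivity)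
      _ = (C * A₀) * Λ ^ 2 := by ring
      _ ≤ (A₀ + C * A₀ + C + 1) * Λ ^ 2 := by gcongr; nlinarith
  have hpos : ∀ σ : ℝ, σ ∈ Icc (-(1 / 2) : ℝ) (3 / 2) →
      ‖(riemannZeta (σ + T * I))⁻¹‖ ≤
        (A₀ + C * A₀ + C + 1) * Real.exp ((A₀ + C * A₀ + C + 1) * Λ ^ 2) := by
    intro σ hσ
    have h := hinv T η (by rw [hTabs]; exact hT2) hη (by linarith) hsep σ hσ
    calc ‖(riemannZeta (σ + T * I))⁻¹‖ ≤ C * Real.exp (C * Real.log (|T| + 4) / η) := h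
      _ ≤ (A₀ + C * A₀ + C + 1) * Real.exp ((A₀ + C * A₀ + C + 1) * Λ ^ 2) := by
          refine mul_le_mul (by nlinarith) (Real.exp_le_exp.2 hkey) (Real.exp_pos _).le
            (by positivity)
  refine ⟨T, hNT, hTN, ⟨η, hη, hη2, ?_, hsep⟩, fun σ hσ ↦ ⟨hpos σ hσ, ?_⟩⟩
  · calc 1 / η ≤ A₀ * Λ := hηA
      _ ≤ (A₀ + C * A₀ + C + 1) * Λ := by gcongr; nlinarith
  · rw [norm_inv_riemannZeta_neg_im]
    exact hpos σ hσ

end Literature.NumberTheory.LFunctions
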